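import Summits.Ventures.HodgeRepro2.T6N4Hyp
import Summits.Ventures.HodgeRepro2.T6N41ToyE
import Summits.Ventures.HodgeRepro2.T6N3Toy
import Summits.Ventures.HodgeRepro2.T6N43Toy

/-!
# T6N4Toy — non-vacuity witnesses for the two N4 bridge displays (README §10.5(ii)(c)/(d))

The displays of `T6N4Hyp` hold jointly on the owners' accepted toys: t6-p3's toy side `N3Toy.side` (`σ = ⊤`),
t6-p4's `N41Toy.toyDatum` (one place, `thetaNonzero ≡ True`) and t6-p6's `N43Toy.toyU11` — so neither display is
closed by `trivial` / `simp` / `decide` on a general datum, and both are satisfiable together with the N4.1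
displays (`N41Toy.toy_N41E`).  §8(d): uses an L-value-free non-vanishing device: NO.
-/

namespace Summit.Ventures.HodgeRepro2.T6
namespace N4Toy

/-- GQT Thm 11.7(ii) holds on the toys: the toy side's `σ` is `⊤ ≠ ⊥` (`ℂ` is non-trivial). -/
theorem toy_thm11_7 : Hyp.GQT2014_Thm11_7_ii N3Toy.side N41Toy.toyDatum := fun _ _ => by
  simp

/-- The «obvious» direction of GQT Conj. 11.5 holds on the toys (`thetaNonzero ≡ True`). -/
theorem toy_conj11_5 : Hyp.GQT2014_Conj11_5_obvious N43Toy.toyU11 N41Toy.toyDatum () := fun _ => trivial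

/-- Both bridge displays instantiate simultaneously with `(H_loc)` and (R1) of the toy N4.1 datum: the
bridges fire on the toy. -/
theorem toy_bridges : N3Toy.side.σ ≠ ⊥ ∧ N41Toy.toyDatum.thetaNonzero () :=
  ⟨toy_thm11_7 N41Toy.toy_hloc N41Toy.toy_N41E.1, toy_conj11_5 N43Toy.toyU11_zetaStar_ne_zero⟩

end N4Toy
end Summit.Ventures.HodgeRepro2.T6
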